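import Summits.NavierStokesRegularity.FluidComputer.GateBudgetComb
import Summits.NavierStokesRegularity.FluidComputer.GateBudgetCombMember
import HarnessLib

/-!
# What no tuning can beat, part 24b: THE COMB'S PROFILE — after its pulse the output of EVERY
# member of the knob family is pinned to `|sin(π·w)|`, `w = ε/(Mρ²) = 1/(σ_knob M)` its winding
# number, up to the phase budget and the drift; at `M = K¹⁰` the band is `±71/1000`

Cell `pub-fluidc`, blueprint seat bp1 (gen 30, third item, second half); same namespace and
conventions as parts 1–23 (`GateBudget*.lean`); imports part 23 (`GateBudgetComb`: the numerics
at `M = K¹⁰`, and through it parts 20, 21, 22a, 22b) and part 24a (`GateBudgetCombMember`: the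
winding phase, the general exit, the member capped / fired given the levels). Modes `0 = a`
input, `1 = b` clock, `2 = c` catalyst (`u = c/ρ²`), `3 = d` transfer, `4 = ã` output;
`σ_knob = ρ²/ε`. HONEST FRAMING (verbatim): low prior, high value-of-information experiment on
Tao's machine paradigm; NOT a claim that NS blows up.

THE POINT. Parts 20–23 pinned the two EXTREMES of the knob's response: on the lattice
`w = ε/(Mρ²) = k` the member is a dud (`ã² ≤ 1/100` at `M = K¹⁰`), on the half lattice `w = k + ½`
it fires (`ã ≥ 3/4`). Part 24a showed, given the levels, that ANY member exits at phase
`wπ ± ψ` and is capped behind `|cos wπ|` and fired by `|sin wπ|`. §71 (`knob_member_profile`)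
discharges the levels by part 19 for every member with `ρ² ≤ ε`, `Mρ⁴ ≤ ε²` under the polynomial
trigger hypotheses: at its own dousing time `T` the member exits at phase `wπ ± (ψ + D)` and its
output is capped by `1 - (|cos wπ| - ψ - D)² + A` up to `T + 1/8` and floored by every admissible
`θ` from `T + 1/8` on. §72 puts in Tao's amplifier `M = K¹⁰` (`knob_member_profile_headline`):
for `K ≥ 16`, `ε² ≤ 1/(6K²⁰)` and EVERY knob with `200ε/K²⁰ ≤ ρ² ≤ 2ε/K¹⁰` (winding number
`1/2 ≤ w ≤ K¹⁰/200`), `ψ + D = 71/1000` and `A, A′ ≤ 10⁻³`: `|a(T)| = |cos wπ| ± 0.071`,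
`|d(T)| = |sin wπ| ± 0.071`, `ã² ≤ 1 - (|cos wπ| - 0.071)² + 10⁻³` up to `T + 1/8`, and `ã ≥ θ`
from `T + 1/8` on for every `θ ≥ 0` with `θ ≤ (K/8)((|sin wπ| - 0.071)² - 10⁻³ - θ²)`. THE GATE'S
TRANSFER CURVE IN THE PUMP RATE IS `|sin(π/(σ_knob M))|`: the comb of parts 20–23 is this curve
sampled at its zeros and its maxima; between them the output takes every intermediate level, so
at scale `σ_knob M ~ 1` the gate is not a switch but an interferometer.

HONEST LIMITS. (i) FIRST ORDER: `|sin Θ| ≥ |sin wπ| - ψ` is the Lipschitz bound; at the lattice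
and half-lattice points parts 17/20/22/23 give the SECOND-order pins (`1 - ψ²/2`), which this
file does not reproduce (the dud cap here would be `0.14` at `w = k`, not `1/100`). (ii) The cap
holds on `[0, T + 1/8]` only and the floor from `T + 1/8` on only, `T` the member's own dousing
time; no common instant across members, nothing on the rise during `[T, T + 1/8]`, no second-pulse
exclusion for capped members. (iii) The floor is the LINEAR drain bound of part 22a over a window
of length `1/8`: `θ` solves `θ ≤ (K/8)(m - θ²)`, i.e. `θ ≈ √m - 4/K`, not `√m`. (iv) The phase
budget grows like `πw·100/(49M)`: informative for `w ≪ M` only; numbers only at `M = K¹⁰` and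
`w ≤ K¹⁰/200` (one factor 2 lost to reuse part 23's window numerics). (v) Nothing about members
with `Mρ⁴ > ε²` (winding below `1/√M`), about other amplifiers, or about Navier–Stokes.
[cite: Tao2016AveragedNS, §5.5 Theorem 5.3, (5.5), (5.6), (b-eq), (c-eq), (tcable)]
-/

noncomputable section

namespace Summit.NavierStokesRegularity.FluidComputer.GateBudget

open Real Set Filter Topology
open Literature.Analysis.FluidPDE.Tao2016AveragedNS

variable {K M ε ρ : ℝ} {X : ℝ → Fin 5 → ℝ} {C : ℝ → ℝ}

/-! ## §71 The general member, from the dynamics: the profile of the comb -/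

/-- **THE PROFILE OF THE COMB — from the dynamics.** Along an exact trajectory of
`rotorCircuit K M ε ρ` from (5.6) with `0 < ρ² ≤ ε`, `Mρ⁴ ≤ ε²`, written `ε = wMρ²`
(`w = ε/(Mρ²) = 1/(σ_knob M)` the winding number; NO lattice condition), under the polynomial
trigger hypotheses `16 ≤ K`, `48 log K ≤ M ≤ K¹⁰`, `ε² ≤ 1/(6K²⁰)` and with
`(8/M)log(25εK¹⁰/(8ρ²)) + 200/(169M - 400) ≤ Δ < 1/16`: there are times `1 ≤ s₀ ≤ 3/2 < T`,
`T - s₀ ≤ Δ` (the member's OWN critical and dousing times, part 19) such that, for ANY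
`ψ ≥ 6/(MK¹⁰) + 16e^{-M}/M² + (κ·π·100/(49M) + 10e^{-M}Δ/(7M))/(1 - 100/(49M)) + 3/(2K¹⁰)`
(`κ ≥ w`) and `D ≥ 6(ε + Pe^{-M} + 3/K⁹) + 2(ε + Pe^{-M} + 3/K⁹ + K²Δ)Δ` (`P ≥ ρ²`):
(EXIT) `|a(T)| = |cos wπ| ± (ψ + D)` and `|d(T)| = |sin wπ| ± (ψ + D)` (two-sided);
(CAP) if `|cos wπ| - ψ - D ≥ 0` then `ã(t)² ≤ 1 - (|cos wπ| - ψ - D)² + A` for all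
`t ∈ [0, T + 1/8]`, `A = 16(K⁻¹⁰ + 4e^{-M}/M + ε)/M + 4e^{-M}/M`;
(FLOOR) if `|sin wπ| - ψ - D ≥ 0` then for every `θ ≥ 0` with
`θ ≤ (K/8)((|sin wπ| - ψ - D)² - A′ - θ²)`, `A′ = 8(K⁻¹⁰ + 4e^{-M}/M)/M + e^{-M}/M`,
`ã(t) ≥ θ` for all `t ≥ T + 1/8`. §70 with every level discharged by part 19's
`knob_dynamic_levels` (`β = ε/4`, `λ₀ = K⁻¹⁰ + 4e^{-M}/M`, `ϱ = 7ε/10`, `b₁ = ε/2`, `γ₁ = ρ²/K¹⁰`,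
`φ₀ = 3/(2K¹⁰)`) and part 20/22's closed forms (`lattice_drift_le`, `winding_psi_le`).
Parts 20 (`w = k`) and 22 (`w = k + ½`) are its second-order refinements at the extremes.
[cite: Tao2016AveragedNS, §5.5 Theorem 5.3, (5.5), (5.6), (b-eq), (c-eq), (tcable)] -/
theorem knob_member_profile
    (hX : ∀ t, HasDerivAt X (RotorKnob.rotorCircuit K M ε ρ (X t)) t)
    (h0 : X 0 = delayInit) (hε : 0 < ε) (hρ : 0 < ρ) (hρε : ρ ^ 2 ≤ ε)
    (hMρ : M * ρ ^ 4 ≤ ε ^ 2) (hM : 0 < M) (hMK : M ≤ K ^ 10) (hK : 16 ≤ K)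
    (hML : 48 * Real.log K ≤ M) (hεK : ε ^ 2 ≤ 1 / (6 * K ^ 20))
    (hC : ∀ t, HasDerivAt C (X t 2) t) (w : ℝ) (hk : ε = w * M * ρ ^ 2)
    {κ P Δ ψ D : ℝ} (hκ : w ≤ κ) (hP : ρ ^ 2 ≤ P)
    (hΔ : 8 * log (25 * ε * K ^ 10 / (8 * ρ ^ 2)) / M + 200 / (169 * M - 400) ≤ Δ)
    (hH : Δ < 1 / 16)
    (hψ : 6 / (M * K ^ 10) + 16 * exp (-M) / M ^ 2
        + (κ * (π * (100 / (49 * M))) + 10 * exp (-M) * Δ / (7 * M)) / (1 - 100 / (49 * M))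
        + 3 / (2 * K ^ 10) ≤ ψ)
    (hD : 6 * (ε + P * exp (-M) + 3 / K ^ 9)
        + 2 * (ε + P * exp (-M) + 3 / K ^ 9 + K ^ 2 * Δ) * Δ ≤ D) :
    ∃ s₀ T : ℝ, 1 ≤ s₀ ∧ s₀ ≤ 3 / 2 ∧ s₀ < T ∧ T - s₀ ≤ Δ ∧
      (|X T 0| ≤ |cos (w * π)| + ψ + D ∧ |X T 3| ≤ |sin (w * π)| + ψ + D ∧
        |cos (w * π)| - ψ - D ≤ |X T 0| ∧ |sin (w * π)| - ψ - D ≤ |X T 3|) ∧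
      (0 ≤ |cos (w * π)| - ψ - D → ∀ t ∈ Icc 0 (T + 1 / 8),
        X t 4 ^ 2 ≤ 1 - (|cos (w * π)| - ψ - D) ^ 2
          + (16 * (1 / K ^ 10 + 4 * exp (-M) / M + ε) / M + 4 * exp (-M) / M)) ∧
      (0 ≤ |sin (w * π)| - ψ - D → ∀ θ : ℝ, 0 ≤ θ →
        θ ≤ K / 8 * ((|sin (w * π)| - ψ - D) ^ 2
          - (8 * (1 / K ^ 10 + 4 * exp (-M) / M) / M + exp (-M) / M) - θ ^ 2) →
        ∀ t, T + 1 / 8 ≤ t → θ ≤ X t 4) := by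
  have hK0 : 0 < K := by linarith
  have hK1 : 1 ≤ K := by linarith
  have hε2 : 0 < ε ^ 2 := by positivity
  -- the winding number is positive
  have hw' : w = ε / (M * ρ ^ 2) := by
    rw [eq_div_iff (by positivity), hk]; ring
  have hw0 : 0 < w := by rw [hw']; positivity
  have hM133 : 133 ≤ M := by
    have h16 : log 16 = 4 * log 2 := by
      rw [show (16 : ℝ) = 2 ^ 4 by norm_num, Real.log_pow]; norm_num
    have hlogK : log 16 ≤ log K := log_le_log (by norm_num) hK
    linarith [Real.log_two_gt_d9]
  have hε1 : ε ≤ 1 := by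
    have hK20 : (1700 : ℝ) ≤ K ^ 20 :=
      le_trans (by norm_num) (pow_le_pow_left₀ (by norm_num) hK 20)
    have h1 : ε ^ 2 ≤ 1 := by
      refine hεK.trans ?_
      rw [div_le_one (by positivity)]; linarith
    nlinarith
  -- part 19: the levels at the member's critical time `s₀` and dousing time `T`
  obtain ⟨s₀, T, hs1, hs32, hsT, hTΔ, hcpos, harm, hbs, hcs, hbT, hcT, hΦ, ha₀, haT, -, -⟩ :=
    knob_dynamic_levels hX h0 hε hρ hρε hM hMK hK hML hεK hMρ hC (lt_of_le_of_lt hΔ hH)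
  have hTΔ' : T - s₀ ≤ Δ := hTΔ.trans hΔ
  have hs0 : 0 ≤ s₀ := by linarith
  -- the critical ratio is subunit on the window radius `ϱ = 7ε/10`
  have hq : ε ^ 2 < M * (7 / 10 * ε) ^ 2 := by
    have hMε : 133 * ε ^ 2 ≤ M * ε ^ 2 := mul_le_mul_of_nonneg_right hM133 hε2.le
    have h49 : M * (7 / 10 * ε) ^ 2 = 49 / 100 * (M * ε ^ 2) := by ring
    rw [h49]; linarith
  -- the self-timed window `β/(2ε) = 1/8`, the afterglows `2ελ₀/(Mβ) = 8λ₀/M`,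
  -- `4ε(λ₀ + ε)/(Mβ) = 16(λ₀ + ε)/M`
  have h8 : ε / 4 / (2 * ε) = 1 / 8 := by
    field_simp; ring
  have hA : 2 * ε * (1 / K ^ 10 + 4 * exp (-M) / M) / (M * (ε / 4))
      = 8 * (1 / K ^ 10 + 4 * exp (-M) / M) / M := by
    field_simp; ring
  have hA2 : 4 * ε * (1 / K ^ 10 + 4 * exp (-M) / M + ε) / (M * (ε / 4))
      = 16 * (1 / K ^ 10 + 4 * exp (-M) / M + ε) / M := by
    field_simp; ring
  -- the closed forms of the phase budget (part 22) and of the drift (part 20)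
  have hψ' := (winding_psi_le w hw0.le hk hκ hε hρ hM133 hK0 hTΔ').trans hψ
  have hD' := (lattice_drift_le hK1 hε.le hP hs0 hs32 (by linarith) hTΔ' ha₀ haT).trans hD
  -- §69: the exit at phase `wπ`
  have hη := knob_swing_lower (b₁ := ε / 2) (γ₁ := ρ ^ 2 / K ^ 10) (β := ε / 4)
    (lam₀ := 1 / K ^ 10 + 4 * exp (-M) / M) (by positivity) hbs (hcpos s₀ ⟨le_rfl, hsT.le⟩)
    hcs.le (by positivity) hbT (hcpos T ⟨hsT.le, le_rfl⟩) hcT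
  have hph := knob_winding_phase hX h0 hε hρ hM hC w hw0.le hk hsT.le (by positivity) hq hcpos
    harm hη hΦ
  obtain ⟨⟨hd1, hd2⟩, ha1, ha2⟩ :=
    knob_phase_exit hX h0 hC hε.le hK0.le hs0 hsT.le (hph.trans hψ')
  refine ⟨s₀, T, hs1, hs32, hsT, hTΔ', ⟨by linarith, by linarith, by linarith, by linarith⟩,
    fun hm t ht => ?_, fun hm θ hθ hfire t ht => ?_⟩
  · -- §70: the cap, with the levels of part 19 and the closed forms
    have ht' : t ∈ Icc 0 (T + ε / 4 / (2 * ε)) := by rw [h8]; exact ht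
    have hcap := knob_member_cap hX h0 hε hε1 hρ hρε hM hK0.le hC w hw0.le hk
      (ϱ := 7 / 10 * ε) (β := ε / 4) (b₁ := ε / 2) (γ₁ := ρ ^ 2 / K ^ 10)
      (lam₀ := 1 / K ^ 10 + 4 * exp (-M) / M) (φ₀ := 3 / (2 * K ^ 10)) (ψ := ψ) (D := D)
      hs0 hsT.le (by positivity) hq hcpos harm (by positivity) hbs hcs.le (by positivity)
      hbT hcT hΦ hψ' hD' hm ht'
    rw [hA2] at hcap
    exact hcap
  · -- §70: the floor, with the levels of part 19 and the closed forms
    have hfire' : θ ≤ K * ((|sin (w * π)| - ψ - D) ^ 2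
        - (2 * ε * (1 / K ^ 10 + 4 * exp (-M) / M) / (M * (ε / 4)) + exp (-M) / M) - θ ^ 2)
          * (ε / 4 / (2 * ε)) := by
      rw [hA, h8]; linarith
    obtain ⟨-, -, hfired⟩ := knob_member_fire hX h0 hε hρ hM hK0.le hC w hw0.le hk
      (ϱ := 7 / 10 * ε) (β := ε / 4) (b₁ := ε / 2) (γ₁ := ρ ^ 2 / K ^ 10)
      (lam₀ := 1 / K ^ 10 + 4 * exp (-M) / M) (φ₀ := 3 / (2 * K ^ 10)) (ψ := ψ) (D := D)
      (θ := θ) hs0 hsT.le (by positivity) hq hcpos harm (by positivity) hbs hcs.le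
      (by positivity) hbT hcT hΦ hψ' hD' hm hθ hfire'
    rw [h8] at hfired
    exact hfired t ht

/-! ## §72 The profile at Tao's amplifier `M = K¹⁰` -/

/-- **The member's window length, at `M = K¹⁰`.** Part 21's `headline_delta` written for one
member: `20ε/K²⁰ ≤ ρ²` ⇒ `(8/K¹⁰)log(25εK¹⁰/(8ρ²)) + 200/(169K¹⁰ - 400) ≤ 242/K⁹`
(`log` is monotone: `25εK¹⁰/(8ρ²) ≤ 25εK¹⁰/(4ρ²)`). [folklore numerics] -/
theorem profile_delta {K ε ρ : ℝ} (hK : 16 ≤ K) (hε : 0 < ε) (hρ : 0 < ρ)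
    (hlo : 20 * ε / K ^ 20 ≤ ρ ^ 2) :
    8 * log (25 * ε * K ^ 10 / (8 * ρ ^ 2)) / K ^ 10 + 200 / (169 * K ^ 10 - 400)
      ≤ 242 / K ^ 9 := by
  have hK0 : 0 < K := by linarith
  have hK10 : 0 < K ^ 10 := by positivity
  have h := headline_delta hK hε hlo
  have hx : 0 < 25 * ε * K ^ 10 / (8 * ρ ^ 2) := by positivity
  have hle : 25 * ε * K ^ 10 / (8 * ρ ^ 2) ≤ 25 * ε * K ^ 10 / (4 * ρ ^ 2) :=
    div_le_div_of_nonneg_left (by positivity) (by positivity) (by nlinarith [sq_nonneg ρ])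
  have hlog : log (25 * ε * K ^ 10 / (8 * ρ ^ 2)) ≤ log (25 * ε * K ^ 10 / (4 * ρ ^ 2)) :=
    log_le_log hx hle
  have h8 : 8 * log (25 * ε * K ^ 10 / (8 * ρ ^ 2)) / K ^ 10
      ≤ 8 * log (25 * ε * K ^ 10 / (4 * ρ ^ 2)) / K ^ 10 :=
    div_le_div_of_nonneg_right (by linarith) hK10.le
  linarith

/-- **THE PROFILE OF THE COMB AT TAO'S AMPLIFIER `M = K¹⁰`.** For `K ≥ 16`, `0 < ε`,
`ε² ≤ 1/(6K²⁰)` and an exact trajectory of `rotorCircuit K K¹⁰ ε ρ` from (5.6) with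
`200ε/K²⁰ ≤ ρ² ≤ 2ε/K¹⁰` — ANY member with winding number `w = ε/(K¹⁰ρ²)` between `1/2` and
`K¹⁰/200`, no lattice condition — there are times `1 ≤ s₀ ≤ 3/2 < T ≤ s₀ + 242/K⁹` (its own)
such that: (EXIT) `||a(T)| - |cos wπ|| ≤ 71/1000` and `||d(T)| - |sin wπ|| ≤ 71/1000`;
(CAP) if `|cos wπ| ≥ 71/1000` then `ã(t)² ≤ 1 - (|cos wπ| - 71/1000)² + 10⁻³` for all
`t ∈ [0, T + 1/8]`; (FLOOR) if `|sin wπ| ≥ 71/1000` then for every `θ ≥ 0` with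
`θ ≤ (K/8)((|sin wπ| - 71/1000)² - 10⁻³ - θ²)`, `ã(t) ≥ θ` for all `t ≥ T + 1/8` — §71 at
`M = K¹⁰`, `Δ = 242/K⁹`, `ψ = 7/100`, `D = 10⁻³` with EVERY largeness hypothesis discharged by
part 21 (`headline_trigger`, `headline_drift`, `headline_afterglow`), part 23 (`teeth_psi` at
`κ = 2w`, `teeth_afterglow`) and `profile_delta`. THE GATE'S TRANSFER CURVE IN THE PUMP RATE IS
`|sin(π/(σ_knob K¹⁰))|` to within `±0.071` at clock death, and the output after the pulse follows
it: below `√(1 - (|cos wπ| - 0.071)² + 10⁻³)` until `T + 1/8`, above `θ ≈ |sin wπ| - 0.071 - 4/K`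
from `T + 1/8` on. HONEST LIMITS (i)–(v) of the header.
[cite: Tao2016AveragedNS, §5.5 Theorem 5.3, (5.5), (5.6), (b-eq), (c-eq), (tcable)] -/
theorem knob_member_profile_headline {K ε ρ : ℝ} {X : ℝ → Fin 5 → ℝ} {C : ℝ → ℝ}
    (hX : ∀ t, HasDerivAt X (RotorKnob.rotorCircuit K (K ^ 10) ε ρ (X t)) t)
    (h0 : X 0 = delayInit) (hC : ∀ t, HasDerivAt C (X t 2) t) (hK : 16 ≤ K) (hε : 0 < ε)
    (hεK : ε ^ 2 ≤ 1 / (6 * K ^ 20)) (hρ : 0 < ρ) (hlo : 200 * ε / K ^ 20 ≤ ρ ^ 2)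
    (hhi : K ^ 10 * ρ ^ 2 ≤ 2 * ε) :
    ∃ s₀ T : ℝ, 1 ≤ s₀ ∧ s₀ ≤ 3 / 2 ∧ s₀ < T ∧ T - s₀ ≤ 242 / K ^ 9 ∧
      (|X T 0| ≤ |cos (ε / (K ^ 10 * ρ ^ 2) * π)| + 71 / 1000 ∧
        |X T 3| ≤ |sin (ε / (K ^ 10 * ρ ^ 2) * π)| + 71 / 1000 ∧
        |cos (ε / (K ^ 10 * ρ ^ 2) * π)| - 71 / 1000 ≤ |X T 0| ∧
        |sin (ε / (K ^ 10 * ρ ^ 2) * π)| - 71 / 1000 ≤ |X T 3|) ∧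
      (71 / 1000 ≤ |cos (ε / (K ^ 10 * ρ ^ 2) * π)| → ∀ t ∈ Icc 0 (T + 1 / 8),
        X t 4 ^ 2 ≤ 1 - (|cos (ε / (K ^ 10 * ρ ^ 2) * π)| - 71 / 1000) ^ 2 + 1 / 1000) ∧
      (71 / 1000 ≤ |sin (ε / (K ^ 10 * ρ ^ 2) * π)| → ∀ θ : ℝ, 0 ≤ θ →
        θ ≤ K / 8 * ((|sin (ε / (K ^ 10 * ρ ^ 2) * π)| - 71 / 1000) ^ 2 - 1 / 1000 - θ ^ 2) →
        ∀ t, T + 1 / 8 ≤ t → θ ≤ X t 4) := by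
  have hK0 : 0 < K := by linarith
  have hK10 : 0 < K ^ 10 := by positivity
  have h10 : (1024 : ℝ) ≤ K ^ 10 := le_trans (by norm_num) (pow_le_pow_left₀ (by norm_num) hK 10)
  have h9 : (68719476736 : ℝ) ≤ K ^ 9 := by
    have := headline_pow_floor hK 9; norm_num at this; exact this
  have hH : (242 : ℝ) / K ^ 9 < 1 / 16 := by
    rw [div_lt_div_iff₀ (by positivity) (by norm_num)]; linarith [h9]
  have hΔ0 : (0 : ℝ) ≤ 242 / K ^ 9 := by positivity
  -- the member's winding number `w = ε/(K¹⁰ρ²) ≤ κ := 2w`, and `20ε/K²⁰ ≤ 200ε/K²⁰ ≤ ρ²`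
  have hk : ε = ε / (K ^ 10 * ρ ^ 2) * K ^ 10 * ρ ^ 2 := by
    field_simp
  have hw0 : 0 ≤ ε / (K ^ 10 * ρ ^ 2) := by positivity
  have hκ : ε / (K ^ 10 * ρ ^ 2) ≤ 2 * ε / (K ^ 10 * ρ ^ 2) :=
    div_le_div_of_nonneg_right (by linarith) (by positivity)
  have hlo20 : 20 * ε / K ^ 20 ≤ ρ ^ 2 :=
    le_trans (div_le_div_of_nonneg_right (by linarith) (by positivity)) hlo
  -- `ρ² ≤ 2ε/K¹⁰ ≤ ε` and `K¹⁰ρ⁴ ≤ 2ερ² ≤ 4ε²/K¹⁰ ≤ ε²`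
  have hρε : ρ ^ 2 ≤ ε := by nlinarith [sq_nonneg ρ]
  have hMρ : K ^ 10 * ρ ^ 4 ≤ ε ^ 2 := by
    have h1 : K ^ 10 * ρ ^ 4 = (K ^ 10 * ρ ^ 2) * ρ ^ 2 := by ring
    have h2 : K ^ 10 * ρ ^ 4 ≤ 2 * ε * ρ ^ 2 := by
      rw [h1]; exact mul_le_mul_of_nonneg_right hhi (sq_nonneg ρ)
    have h3 : K ^ 10 * (2 * ε * ρ ^ 2) ≤ 2 * ε * (2 * ε) := by nlinarith
    nlinarith
  -- the numerics of parts 21 and 23: `ψ = 7/100`, `D = 10⁻³`, `A, A′ ≤ 10⁻³`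
  have hψ := teeth_psi hK hε hlo hΔ0 (by linarith : (242 : ℝ) / K ^ 9 ≤ 1)
  have hD := headline_drift hK hεK hhi
  have hAd := headline_afterglow hK hεK (ε := ε)
  have hAf := teeth_afterglow hK
  obtain ⟨s₀, T, hs1, hs2, hsT, hTs, ⟨ha1, hd1, ha2, hd2⟩, hcap, hfire⟩ :=
    knob_member_profile hX h0 hε hρ hρε hMρ hK10 le_rfl hK (headline_trigger hK) hεK hC
      (ε / (K ^ 10 * ρ ^ 2)) hk (P := ρ ^ 2) hκ le_rfl (profile_delta hK hε hρ hlo20) hH hψ hD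
  refine ⟨s₀, T, hs1, hs2, hsT, hTs, ⟨by linarith, by linarith, by linarith, by linarith⟩,
    fun hc t ht => ?_, fun hs θ hθ hθK t ht => ?_⟩
  · have h := hcap (by linarith) t ht
    have he : (|cos (ε / (K ^ 10 * ρ ^ 2) * π)| - 7 / 100 - 1 / 1000)
        = |cos (ε / (K ^ 10 * ρ ^ 2) * π)| - 71 / 1000 := by ring
    rw [he] at h
    linarith
  · have he : (|sin (ε / (K ^ 10 * ρ ^ 2) * π)| - 7 / 100 - 1 / 1000)
        = |sin (ε / (K ^ 10 * ρ ^ 2) * π)| - 71 / 1000 := by ring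
    refine hfire (by linarith) θ hθ ?_ t ht
    rw [he]
    have hK8 : 0 ≤ K / 8 := by positivity
    have hmono : K / 8 * ((|sin (ε / (K ^ 10 * ρ ^ 2) * π)| - 71 / 1000) ^ 2 - 1 / 1000 - θ ^ 2)
        ≤ K / 8 * ((|sin (ε / (K ^ 10 * ρ ^ 2) * π)| - 71 / 1000) ^ 2
          - (8 * (1 / K ^ 10 + 4 * exp (-K ^ 10) / K ^ 10) / K ^ 10 + exp (-K ^ 10) / K ^ 10)
          - θ ^ 2) :=
      mul_le_mul_of_nonneg_left (by linarith) hK8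
    exact hθK.trans hmono

end Summit.NavierStokesRegularity.FluidComputer.GateBudget
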